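import Mathlib
import Summits.Ventures.PercRepro2.Defs
import Summits.Ventures.PercRepro2.Independence
import Summits.Ventures.PercRepro2.Harris
import Summits.Ventures.PercRepro2.CoinDefs
import Summits.Ventures.PercRepro2.CoinArcsOff
import Summits.Ventures.PercRepro2.CoinPendantDefs
import Summits.Ventures.PercRepro2.CoinPendant
import Summits.Ventures.PercRepro2.CoinInduced
import Summits.Ventures.PercRepro2.CoinVdBK
import Summits.Ventures.PercRepro2.CoinBHK
import Summits.Ventures.PercRepro2.CoinReverse
import Summits.Ventures.PercRepro2.CoinTwoPendantDefs
import Summits.Ventures.PercRepro2.CoinTwoPendantMass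
import Summits.Ventures.PercRepro2.CoinTraceLevels
import Summits.Ventures.PercRepro2.CoinTraceTower
import Summits.Ventures.PercRepro2.CoinTracePin

/-!
# (CU-PA) on a TWO-COIN cylinder, by pinning twice (blind cell PercRepro2, night-2 g3;
proofs/NIGHT2-DARC.md §19)

A pendant vertex `v` whose membership in `K⁻` is «both coins `c₁`, `c₂` open» (the inner vertex
`v₁` of a pendant path `w → v₁ → v₂ → t`: `v₁ ∈ K⁻ ⟺ v₁ → v₂ and v₂ → t open`).  Pinning both
coins open leaves a product law, `trace_bhk` applies, and the pinning identities translate its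
trace law back exactly as in `trace_cu_pa`: `μ_Z = p_{c₁} p_{c₂} μ″_Z` for `Z ∋ v`, `μ″_Z = 0`
for `Z ∌ v`.  Result (`trace_cu_pa₂`): the (CU-PA) inequality on the cylinder family `{Z ∋ v}`.
-/

namespace Summit.Ventures.PercRepro2.Coin

section CUPA2

open Classical

variable {V : Type*} {E : Type*} [Fintype V] [DecidableEq V] [Fintype E] [DecidableEq E]
  {R : Type*} [Field R] [LinearOrder R] [IsStrictOrderedRing R]

omit [Fintype V] [DecidableEq V] [Fintype E] [DecidableEq E] in
/-- A level containing `v` lies in `{c₁ open} ∩ {c₂ open}`. -/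
lemma traceLevel_subset_openEdge₂ {arcs : E → Finset (V × V)} {P : Finset V} {t v : V}
    (hv : v ∈ P) {c₁ c₂ : E} (hleaf : bwdEvent arcs v {t} = openEdge c₁ ∩ openEdge c₂)
    {Z : Finset V} (hvZ : v ∈ Z) :
    traceLevel arcs {t} P Z ⊆ openEdge c₁ ∩ openEdge c₂ := by
  intro ω hω
  rw [← hleaf]
  exact (hω v hv).mp hvZ

omit [Fintype V] [DecidableEq V] [Fintype E] [DecidableEq E] in
/-- A level avoiding `v` lies in `{c₁ closed} ∪ {c₂ closed}`. -/
lemma traceLevel_subset_closedEdge₂ {arcs : E → Finset (V × V)} {P : Finset V} {t v : V}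
    (hv : v ∈ P) {c₁ c₂ : E} (hleaf : bwdEvent arcs v {t} = openEdge c₁ ∩ openEdge c₂)
    {Z : Finset V} (hvZ : v ∉ Z) :
    traceLevel arcs {t} P Z ⊆ closedEdge c₁ ∪ closedEdge c₂ := by
  intro ω hω
  have h : ω ∉ bwdEvent arcs v {t} := fun h => hvZ ((hω v hv).mpr h)
  rw [hleaf] at h
  rw [Set.mem_union, closedEdge_eq_compl, closedEdge_eq_compl, Set.mem_compl_iff,
    Set.mem_compl_iff]
  by_contra hcon
  exact h ⟨not_not.mp (not_or.mp hcon).1, not_not.mp (not_or.mp hcon).2⟩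

omit [Fintype V] [DecidableEq V] [LinearOrder R] [IsStrictOrderedRing R] in
/-- Under a law with `c` pinned open and then another coin pinned, `{c closed}` is null. -/
lemma prob_update_update_closed (p : E → R) {c₁ c₂ : E} (hne : c₁ ≠ c₂) :
    prob (Function.update (Function.update p c₁ 1) c₂ 1) (closedEdge c₁) = 0 := by
  rw [Function.update_comm hne]
  exact prob_update_one_eq_zero_of_subset _ c₁ (subset_refl _)

/-- **(CU-PA) of the trace law on a two-coin cylinder**: for `v ∈ P` with
`{v ∈ K⁻} = {c₁ open} ∩ {c₂ open}` (`c₁ ≠ c₂` pendant coins) and monotone nonnegative `g₁, g₂`,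
`(Σ_{Z ∋ v} g₁ μ)(Σ_{Z ∋ v} g₂ μ) ≤ (Σ_{Z ∋ v} g₁g₂ μ)(Σ_{Z ∋ v} μ)`. -/
theorem trace_cu_pa₂ (p : E → R) (hp : IsProbVec p) {arcs : E → Finset (V × V)}
    (hS : SameEnds arcs) {P : Finset V} {t : V} (hclosed : ClosedOut arcs P {t})
    (hT : TailCoinsIn arcs P {t}) {v : V} (hv : v ∈ P) {c₁ c₂ : E} (hne : c₁ ≠ c₂)
    (hc₁ : c₁ ∈ tailCoins arcs P) (hc₂ : c₂ ∈ tailCoins arcs P)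
    (hleaf : bwdEvent arcs v {t} = openEdge c₁ ∩ openEdge c₂) (s : V) {g₁ g₂ : Set V → R}
    (h₁ : Monotone g₁) (h₂ : Monotone g₂) (h₁0 : ∀ S, 0 ≤ g₁ S) (h₂0 : ∀ S, 0 ≤ g₂ S) :
    (∑ Z ∈ P.powerset.filter (fun Z => v ∈ Z),
        g₁ ↑Z * (prob p (traceLevel arcs {t} P Z) *
          prob p (avoidEvent (arcsOff arcs (P ∪ {t})) s (Z ∪ {t}))))
      * (∑ Z ∈ P.powerset.filter (fun Z => v ∈ Z),
        g₂ ↑Z * (prob p (traceLevel arcs {t} P Z) *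
          prob p (avoidEvent (arcsOff arcs (P ∪ {t})) s (Z ∪ {t})))) ≤
    (∑ Z ∈ P.powerset.filter (fun Z => v ∈ Z),
        g₁ ↑Z * g₂ ↑Z * (prob p (traceLevel arcs {t} P Z) *
          prob p (avoidEvent (arcsOff arcs (P ∪ {t})) s (Z ∪ {t}))))
      * (∑ Z ∈ P.powerset.filter (fun Z => v ∈ Z),
        prob p (traceLevel arcs {t} P Z) *
          prob p (avoidEvent (arcsOff arcs (P ∪ {t})) s (Z ∪ {t}))) := by
  set p₁ := Function.update p c₁ 1 with hp₁def
  set p₂ := Function.update p₁ c₂ 1 with hp₂def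
  have hp₁ : IsProbVec p₁ := hp.update c₁ zero_le_one le_rfl
  have hp₂ : IsProbVec p₂ := hp₁.update c₂ zero_le_one le_rfl
  have hq : 0 ≤ p c₁ * p c₂ := mul_nonneg (hp.nonneg c₁) (hp.nonneg c₂)
  have hp₁c₂ : p₁ c₂ = p c₂ := Function.update_of_ne hne.symm _ _
  -- the reduced events do not see the pendant coins
  have hR : ∀ Z : Finset V, prob p₂ (avoidEvent (arcsOff arcs (P ∪ {t})) s (Z ∪ {t})) =
      prob p (avoidEvent (arcsOff arcs (P ∪ {t})) s (Z ∪ {t})) := fun Z => by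
    rw [hp₂def, prob_update_one_of_dependsOn p₁ c₂ (dependsOn_avoid_reduced_compl_single hT hc₂ s _),
      hp₁def, prob_update_one_of_dependsOn p c₁ (dependsOn_avoid_reduced_compl_single hT hc₁ s _)]
  -- the trace law of the doubly pinned system
  have hμ : ∀ Z : Finset V, v ∈ Z →
      prob p (traceLevel arcs {t} P Z) * prob p (avoidEvent (arcsOff arcs (P ∪ {t})) s (Z ∪ {t}))
        = p c₁ * p c₂ * (prob p₂ (traceLevel arcs {t} P Z) *
          prob p₂ (avoidEvent (arcsOff arcs (P ∪ {t})) s (Z ∪ {t}))) := by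
    intro Z hvZ
    have hsub := traceLevel_subset_openEdge₂ hv hleaf hvZ
    rw [hR Z, prob_eq_mul_prob_update_one_of_subset p c₁ (hsub.trans Set.inter_subset_left),
      prob_eq_mul_prob_update_one_of_subset p₁ c₂ (hsub.trans Set.inter_subset_right), hp₁c₂]
    ring
  have hμ0 : ∀ Z : Finset V, v ∉ Z → prob p₂ (traceLevel arcs {t} P Z) = 0 := by
    intro Z hvZ
    have hsub := traceLevel_subset_closedEdge₂ hv hleaf hvZ
    have h1 : prob p₂ (closedEdge c₁) = 0 := prob_update_update_closed p hne
    have h2 : prob p₂ (closedEdge c₂) = 0 := prob_update_one_eq_zero_of_subset p₁ c₂ (subset_refl _)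
    have hle : prob p₂ (traceLevel arcs {t} P Z) ≤ prob p₂ (closedEdge c₁ ∪ closedEdge c₂) :=
      prob_mono hp₂ hsub
    have hunion := prob_union_add_prob_inter p₂ (closedEdge c₁) (closedEdge c₂)
    have hinter : 0 ≤ prob p₂ (closedEdge c₁ ∩ closedEdge c₂) := prob_nonneg hp₂ _
    have hnn : 0 ≤ prob p₂ (traceLevel arcs {t} P Z) := prob_nonneg hp₂ _
    linarith
  -- sums over the pinned law restrict to `𝒱_v`
  have hsum : ∀ F : Finset V → R,
      ∑ Z ∈ P.powerset.filter (fun Z => Disjoint Z (∅ : Finset V)),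
          F Z * (prob p₂ (traceLevel arcs {t} P Z) *
            prob p₂ (avoidEvent (arcsOff arcs (P ∪ {t})) s (Z ∪ {t}))) =
        ∑ Z ∈ P.powerset.filter (fun Z => v ∈ Z),
          F Z * (prob p₂ (traceLevel arcs {t} P Z) *
            prob p₂ (avoidEvent (arcsOff arcs (P ∪ {t})) s (Z ∪ {t}))) := by
    intro F
    rw [Finset.sum_filter, Finset.sum_filter]
    refine Finset.sum_congr rfl fun Z _ => ?_
    by_cases hvZ : v ∈ Z
    · simp only [Finset.disjoint_empty_right, if_true, hvZ]
    · simp only [Finset.disjoint_empty_right, if_true, hvZ, if_false, hμ0 Z hvZ, zero_mul,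
        mul_zero]
  have hconv : ∀ F : Finset V → R,
      ∑ Z ∈ P.powerset.filter (fun Z => v ∈ Z),
          F Z * (prob p (traceLevel arcs {t} P Z) *
            prob p (avoidEvent (arcsOff arcs (P ∪ {t})) s (Z ∪ {t}))) =
        p c₁ * p c₂ * ∑ Z ∈ P.powerset.filter (fun Z => v ∈ Z),
          F Z * (prob p₂ (traceLevel arcs {t} P Z) *
            prob p₂ (avoidEvent (arcsOff arcs (P ∪ {t})) s (Z ∪ {t}))) := by
    intro F
    rw [Finset.mul_sum]
    refine Finset.sum_congr rfl fun Z hZ => ?_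
    rw [hμ Z (Finset.mem_filter.mp hZ).2]
    ring
  have h := trace_pa p₂ hp₂ hS hclosed hT (Finset.empty_subset P) s h₁ h₂ h₁0 h₂0
  have h1 := hsum (fun Z => g₁ ↑Z)
  have h2 := hsum (fun Z => g₂ ↑Z)
  have h12 := hsum (fun Z => g₁ ↑Z * g₂ ↑Z)
  have h0 := hsum (fun _ => 1)
  simp only [one_mul] at h0
  rw [h1, h2, h12, h0] at h
  have c1 := hconv (fun Z => g₁ ↑Z)
  have c2 := hconv (fun Z => g₂ ↑Z)
  have c12 := hconv (fun Z => g₁ ↑Z * g₂ ↑Z)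
  have c0 := hconv (fun _ => 1)
  simp only [one_mul] at c0
  rw [c1, c2, c12, c0]
  have hsq : 0 ≤ p c₁ * p c₂ * (p c₁ * p c₂) := mul_nonneg hq hq
  have := mul_le_mul_of_nonneg_left h hsq
  calc p c₁ * p c₂ * _ * (p c₁ * p c₂ * _) = p c₁ * p c₂ * (p c₁ * p c₂) * (_ * _) := by ring
    _ ≤ p c₁ * p c₂ * (p c₁ * p c₂) * (_ * _) := this
    _ = _ := by ring

end CUPA2

end Summit.Ventures.PercRepro2.Coin
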